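import Summits.AtomisticToContinuum.Crystallization.Theses.PerronTransitivity

/-!
# Negative knowledge for crux `PerronTransitivity.NoFractionalGain` (K*, stmt-AtomisticToContinuum-15098):
# the level `2E*` is sharp — it cannot be raised by any `η > 0`

Refuter vetting (crux disprover, `--supports stmt-AtomisticToContinuum-15098`).  K* bounds the copositive
Lennard-Jones form below by `2E*·∑cᵢ²`, `E* = ⨅_Q e_LJ(Q)`.  The constant is attained asymptotically already
by CONSTANT weights on large blocks of near-optimal periodic configurations (the tree's trial states
`ChargedEnergyGapNegative.exists_trialState`, item 0714/11865 machinery):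

* `level_sharp` — for every `ε > 0` there are an injective `x : Fin N → ℝ³` and `c ≥ 0` with `∑cᵢ² > 0` and
  `∑_i ∑_{j≠i} cᵢcⱼV_LJ(dist xᵢ xⱼ) < (2E* + ε)·∑cᵢ²`;
* `false_at_raised_level` — hence K* with `2E*` replaced by `2E* + η` is FALSE for every `η > 0`.

So K* is a zero-slack statement: any certificate must be exactly tight on the (unknown) periodic minimisers,
and numerically on the relaxed hcp crystal (`2|e_hcp| = 1.43518`), with the Barlow polytypes fcc/dhcp/9R
within `1.5·10⁻⁴` of the level (route header).  All `[folklore]`.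
-/

noncomputable section

namespace Summit.AtomisticToContinuum.Crystallization.Theorems.NoFractionalGain.Negative.Tightness

open Literature.MathematicalPhysics.StatisticalMechanics
open Summit.AtomisticToContinuum.Crystallization.Theorems.ChargedEnergyGapNegative (eStar exists_trialState)
open scoped BigOperators

/-- With constant weights `c ≡ 1` the form of K* is twice the interaction energy. [folklore] -/
theorem form_const_one {N : ℕ} (x : Fin N → EuclideanSpace ℝ (Fin 3)) :
    ∑ i, ∑ j ∈ Finset.univ.erase i, (1 : ℝ) * 1 * lennardJones (dist (x i) (x j)) =
      2 * interactionEnergy lennardJones x := by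
  rw [two_mul_interactionEnergy]
  simp only [one_mul]
  rfl

/-- **The level of K* is sharp**: for every `ε > 0` some finite injective configuration with non-negative
(indeed constant) weights has form `< (2E* + ε)·∑cᵢ²`. [folklore] -/
theorem level_sharp {ε : ℝ} (hε : 0 < ε) :
    ∃ (N : ℕ) (x : Fin N → EuclideanSpace ℝ (Fin 3)) (c : Fin N → ℝ), Function.Injective x ∧
      (∀ i, 0 ≤ c i) ∧ 0 < ∑ i, c i ^ 2 ∧
      ∑ i, ∑ j ∈ Finset.univ.erase i, c i * c j * lennardJones (dist (x i) (x j)) <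
        (2 * (⨅ Q : PeriodicConfiguration 3, Q.energyPerParticle lennardJones) + ε) * ∑ i, c i ^ 2 := by
  obtain ⟨N, y, hN, hy, hE⟩ := exists_trialState (half_pos hε)
  refine ⟨N, y, fun _ => 1, hy, fun _ => zero_le_one, ?_, ?_⟩
  · simp only [one_pow, Finset.sum_const, Finset.card_univ, Fintype.card_fin, nsmul_eq_mul, mul_one]
    exact_mod_cast hN
  · rw [form_const_one]
    simp only [one_pow, Finset.sum_const, Finset.card_univ, Fintype.card_fin, nsmul_eq_mul, mul_one]
    change interactionEnergy lennardJones y < (N : ℝ) * (eStar + ε / 2) at hE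
    change 2 * interactionEnergy lennardJones y < (2 * eStar + ε) * N
    nlinarith

/-- **K* is false at every raised level** `2E* + η`, `η > 0` (same statement, constant replaced).
[folklore] -/
theorem false_at_raised_level {η : ℝ} (hη : 0 < η) :
    ¬ (∀ (N : ℕ) (x : Fin N → EuclideanSpace ℝ (Fin 3)), Function.Injective x → ∀ c : Fin N → ℝ,
        (∀ i, 0 ≤ c i) →
        (2 * (⨅ Q : PeriodicConfiguration 3, Q.energyPerParticle lennardJones) + η) * ∑ i, c i ^ 2 ≤
          ∑ i, ∑ j ∈ Finset.univ.erase i, c i * c j * lennardJones (dist (x i) (x j))) := by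
  intro h
  obtain ⟨N, x, c, hx, hc, -, hlt⟩ := level_sharp hη
  exact absurd (h N x hx c hc) (not_le.2 hlt)

end Summit.AtomisticToContinuum.Crystallization.Theorems.NoFractionalGain.Negative.Tightness

end
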